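import Summits.BirchSwinnertonDyer.Rank1Residual.X2.RankOneHeegner
import Summits.BirchSwinnertonDyer.Rank1Residual.X11b.CastellaErratumLinks
import Literature.NumberTheory.EllipticCurves.BSDRootNumberSmallConductorProofs
import HarnessLib

/-!
# Class X2, rank `1` (sub-cell X2c): the `Λ`-adic links behind the typed input over `K` —
# which one is a preprint, which one is published, which one is missing (cell `b2b-bsdres`, unit `b2b-bsdres-eisenstein-p2`, gen 2)

HONEST FRAMING (run/shared/lean/b2b/bsd-rank1-residual/, verbatim in every file): the goal of the
cell is to DELETE the COMBINATION-SHAPED residual classes of the Birch–Swinnerton-Dyer formula for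
ALL analytic-rank `≤ 1` elliptic curves over `ℚ` — "full BSD formula for every rank `≤ 1` curve in
class `C`" assembled STRICTLY from published theorems — so that the rank-`≤ 1` remainder becomes
exactly the CONSTRUCTION-SHAPED classes, which are TYPED (missing-input `Prop`s), NOT attempted.
This is not "finishing BSD". Research routes; no claim beyond stated classes. X2c stays
CONSTRUCTION-SHAPED; nothing in this file is a theorem about elliptic curves — it is valuation
bookkeeping that pins WHICH statement at a multiplicative Eisenstein prime is missing.

`X2/RankOneHeegner.lean` (p201343) typed X2c's input as the Heegner-index identity over `K`
(`X2.HeegnerIndexIdentity`, = `X11b.IndexIdentityAt` pointwise). In print that identity is the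
composite of THREE `Λ`-adic statements at the trivial character of the anticyclotomic tower
`K_∞/K` (`p = v v̄` split in `K`), exactly as in the irreducible twin class X11b
(`X11b/CastellaErratumLinks.lean`, p200011, whose shadow structure `X11b.LambdaAdicShadow` —
four integers `ord_p f(0)`, `ord_p L^{BDP}(𝟙)`, `ord_p log_ω P_K`, `ord_p ∏_{w∣N⁺} c_w(E/K)` — is
REUSED here verbatim; at an Eisenstein prime read `f` = a generator of `char X_f` for Keller–Yin's
unramified Selmer group `X_f` over `Λ^ur` and `L^{BDP}` = their `L_f`):
* (IMC) `ord_p f(0) = ord_p L_f(𝟙)` ⇐ "char(X_f) = (L_f) ⊆ Λ^ur" — **Keller–Yin arXiv:2402.12781v2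
  Thm. 4 = Thm. 5.0.4, PREPRINT** (odd multiplicative Eisenstein prime, `K` Heegner for `N` with
  `d_K` odd `≠ −3`, `p` split; both divisibilities, any `φ|_{G_p}`). `X11b.LambdaAdicShadow.IMCAtTrivialChar`.
* (BDP) `ord_p L_f(𝟙) = 2(ord_p log_ω P_K − 1)` ⇐ the `p`-adic Waldspurger/BDP formula for a
  `p`-NEW weight-2 form, **Castella, J. Inst. Math. Jussieu 17 (2018) Thm. 2.10–2.11 — PUBLISHED**
  (§2 there: Coleman integration on the semistable model, no irreducibility; standing hypotheses of
  the paper `p ≥ 5`, split multiplicative) + Mazur 1978 (Manin constant of the optimal curve a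
  `p`-unit) = Castella CJM 6 (2018) Thm. 3.2's shape with `ε_p = 0`, `ord_p(1 − a_p p⁻¹) = −1`.
  `X11b.LambdaAdicShadow.WaldspurgerAt`.
* (CTL) `ord_p f(0) = ord_p #Ш(E/K)[p^∞] + 2((ord_p log_ω P_K − 1) − ord_p [E(K):ℤP_K]) +
  ord_p ∏_{w∣N⁺} c_w(E/K)` ⇐ an anticyclotomic control theorem at a MULTIPLICATIVE prime ALLOWING
  `H⁰(K, E[p^∞]) ≠ 0` — **ANNOUNCED + PUBLISHED pieces, assembled nowhere**: Keller–Yin §7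
  Thm. 7.0.6 / Prop. 7.0.5 (PREPRINT) make "all the assumptions in [JSW2017] except (irred_K) and
  (HT)" — and JSW 2017 §3.1's list is (split), (sst), (τ-dual), (2-dim), (HT), (irred_K),
  (corank 1), (sur), where (sst) = "V semistable at w ∣ p" INCLUDES the non-crystalline =
  multiplicative case (JSW §3.3.3, case (ii)), so the abstract theorem covers `p ‖ N` with torsion
  (its factor `#(E(K)_tors)_p²` and the index in `E(K)/tors` combine to the full index used here,
  KY §7.3); the E-specific local index at the multiplicative `𝔭` is Castella 2018 §2, proof of
  Thm. 2.3 ((eq:calcul)–(eq:tam-p): `ε_p = 0`, `[E(K_𝔭):E₀(K_𝔭)]_p = c_𝔭^{(p)}`, `Ẽ_ns(𝔽_p) ⊗ ℤ_p = 0`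
  for `p > 2`), PUBLISHED — printed under §2.1's irreducible standing hypothesis but not using it.
  `X11b.LambdaAdicShadow.ControlAt`.
* (TAM) `∏_{w∣N⁺} = ∏_{w∣N}` — vacuous here: EVERY `ℓ ∣ N` splits in a Heegner field of the
  conductor. `X11b.LambdaAdicShadow.TamagawaAtRamifiedAt`.
Given the four links, `X11b.display53At_of_shadowLinks` (p200011) yields Castella's (5.3)
(`X11b.Display53At`); this file adds the conversion to `X11b.IndexIdentityAt` (finite `Ш(E/K)`:
`ord_p #Ш[p^∞] = ord_p #Ш`; all `ℓ ∣ N` split: `ord_p ∏_w c_w(E/K) = 2·ord_p ∏_ℓ c_ℓ(E/ℚ)`, a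
transport value taken as a hypothesis as in the X11b lane's `TamagawaDescentAt`) and the
class-level statement `heegnerIndexIdentity_of_links`: if every CellC Heegner datum carries a
shadow satisfying (IMC)+(BDP)+(CTL)+(TAM) and the Tamagawa transport value, `X2.HeegnerIndexIdentity`
holds. So, in the kernel, X2c's typed input = the Keller–Yin PREPRINT (Thm. 5.0.4; Thm. 7.0.6 /
Prop. 7.0.5) + published statements (Castella JIMJ 2018 Thm. 2.11, Castella 2018 §2's local index,
Mazur) assembled nowhere in print — and at `p = 3` (652 of the 705 census pairs) the BDP link is
outside print as well (Castella's `p ≥ 5`).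

References: [KellerYin2024] (PRE) Thm. 5.0.4, §7 Thm. 7.0.6; [Castella2018Exceptional] = JIMJ 17
(2018) Thm. 2.10–2.11; [Castella2018] Thm. 2.3, Thm. 3.2, (5.1)–(5.3); [JetchevSkinnerWan2017]
Thm. 3.3.1, §7.4; [CastellaEtAl2021] Thm. 5.3.1.
-/

set_option autoImplicit false

noncomputable section

open scoped Classical MatrixGroups ModularForm

open CongruenceSubgroup WeierstrassCurve NumberField Literature.NumberTheory.EllipticCurves
  Literature.NumberTheory.EllipticCurves.ModularForms
  Literature.NumberTheory.EllipticCurves.Rank1Residual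

namespace Summit.BirchSwinnertonDyer.Rank1Residual.X2

variable {W : WeierstrassCurve ℚ} {K : Type} [Field K] [NumberField K]
  {P : (W.baseChange K).toAffine.Point} (p : ℕ) [Fact p.Prime]

/-- **Castella's (5.3) ⇒ the Heegner-index identity**, for `Ш(E/K)` finite (`ord_p #Ш(E/K)[p^∞] =
ord_p #Ш(E/K)`) and `K` with every `ℓ ∣ N` split (`ord_p ∏_w c_w(E/K) = 2·ord_p ∏_ℓ c_ℓ(E/ℚ)`,
hypothesis `htamK` — the transport value of JSW 2017 (eq:tamK) / Castella 2018 §5). Bookkeeping.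
[cite: Castella2018, §5 (5.2)–(5.3) (arXiv:1704.06608 p. 12)] -/
theorem indexIdentityAt_of_display53At [Finite (W.baseChange K).sha]
    (hdisp : X11b.Display53At W p K P)
    (htamK : padicValNat p (W.baseChange K).tamagawaProduct = 2 * padicValNat p W.tamagawaProduct) :
    X11b.IndexIdentityAt W p K P := by
  haveI : Finite (AddCommGroup.primaryComponent (W.baseChange K).sha p) :=
    Finite.of_injective _ Subtype.val_injective
  unfold X11b.Display53At at hdisp
  unfold X11b.IndexIdentityAt
  rw [padicValNat_card_addPrimaryComponent] at hdisp
  rw [WeierstrassCurve.shaOrder]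
  have h := hdisp
  rw [htamK] at h
  omega

/-- **The Heegner-index identity at a pair from the three `Λ`-adic links** (IMC: Keller–Yin
Thm. 5.0.4, PREPRINT; BDP: Castella JIMJ 17 (2018) Thm. 2.11 + Mazur, PUBLISHED for `p ≥ 5` split;
CTL: control with torsion at `p ‖ N`, Keller–Yin Thm. 7.0.6 (PREPRINT, JSW's (sst) setting) +
Castella 2018 §2's local index (PUB); TAM vacuous for a Heegner field of the conductor), via `X11b.display53At_of_shadowLinks` and `indexIdentityAt_of_display53At`. Valuation
bookkeeping on a shadow; nothing about the `Λ`-adic objects is constructed or asserted.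
[claim: KellerYin2024, status: under-review] [cite: Castella2018, §5 (5.1)–(5.3) (shape only)] -/
theorem indexIdentityAt_of_shadowLinks [W.IsGloballyMinimal] [Finite (W.baseChange K).sha]
    (S : X11b.LambdaAdicShadow W K P) (hIMC : S.IMCAtTrivialChar) (hBDP : S.WaldspurgerAt)
    (hCTL : S.ControlAt p) (hTAM : S.TamagawaAtRamifiedAt p)
    (htamK : padicValNat p (W.baseChange K).tamagawaProduct = 2 * padicValNat p W.tamagawaProduct) :
    X11b.IndexIdentityAt W p K P :=
  indexIdentityAt_of_display53At p (X11b.display53At_of_shadowLinks p S hIMC hBDP hCTL hTAM) htamK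

/-- The converse conversion: the Heegner-index identity gives Castella's (5.3) back (same two
side facts). Bookkeeping. [cite: Castella2018, §5 (5.2)–(5.3) (arXiv:1704.06608 p. 12)] -/
theorem display53At_of_indexIdentityAt [Finite (W.baseChange K).sha]
    (hid : X11b.IndexIdentityAt W p K P)
    (htamK : padicValNat p (W.baseChange K).tamagawaProduct = 2 * padicValNat p W.tamagawaProduct) :
    X11b.Display53At W p K P := by
  haveI : Finite (AddCommGroup.primaryComponent (W.baseChange K).sha p) :=
    Finite.of_injective _ Subtype.val_injective
  unfold X11b.IndexIdentityAt at hid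
  unfold X11b.Display53At
  rw [padicValNat_card_addPrimaryComponent, htamK]
  rw [WeierstrassCurve.shaOrder] at hid
  omega

/-- Conversely, granted (BDP), (CTL), (TAM), finiteness of `Ш(E/K)` and the Tamagawa transport
value, the Heegner-index identity is EQUIVALENT to (IMC) at the trivial character: on the published
links the content of X2c's typed input at a pair is exactly `ord_p f(0) = ord_p L_f(𝟙)` — one
value of Keller–Yin's Thm. 5.0.4 (PRE) — plus the missing control lemma. Bookkeeping. [folklore] -/
theorem imcAtTrivialChar_iff_indexIdentityAt [W.IsGloballyMinimal] [Finite (W.baseChange K).sha]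
    (S : X11b.LambdaAdicShadow W K P) (hBDP : S.WaldspurgerAt) (hCTL : S.ControlAt p)
    (hTAM : S.TamagawaAtRamifiedAt p)
    (htamK : padicValNat p (W.baseChange K).tamagawaProduct = 2 * padicValNat p W.tamagawaProduct) :
    S.IMCAtTrivialChar ↔ X11b.IndexIdentityAt W p K P := by
  rw [X11b.imcAtTrivialChar_iff_display53At p S hBDP hCTL hTAM]
  exact ⟨fun h => indexIdentityAt_of_display53At p h htamK,
    fun h => display53At_of_indexIdentityAt p h htamK⟩

/-- **Class level: `X2.HeegnerIndexIdentity` from the links.** If every Heegner datum of every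
CellC pair (admissible `K`, datum with `p ∤ c`, Heegner point `P`, `Ś(E/K)` finite) carries a
shadow satisfying (IMC) [Keller–Yin Thm. 5.0.4, PRE], (BDP) [Castella JIMJ 2018, PUB `p ≥ 5`],
(CTL) [Keller–Yin Thm. 7.0.6, PRE, + Castella 2018 §2 local index, PUB] and (TAM) [vacuous], and the
Tamagawa transport value holds, then the typed input `X2.HeegnerIndexIdentity` of
`X2/RankOneHeegner.lean` holds — hence (p201343/p201473) so do `bsdp_of_cellC_of_not_gvPar_of_manin`
etc. This is the kernel form of "X2c at `p ≥ 5` = the Keller–Yin preprint (§5 + §7) + published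
facts (+ X2b for the ψ-odd partners); at `p = 3` the BDP link is outside print too". [claim: KellerYin2024, status: under-review]
[cite: CastellaEtAl2021, Thm. 5.3.1 (shape of the assembly)] -/
theorem heegnerIndexIdentity_of_links
    (hlinks : ∀ (W : WeierstrassCurve ℚ) [W.IsElliptic] [W.IsGloballyMinimal] (p : ℕ) [Fact p.Prime]
      (N : ℕ) [NeZero N] (K : Type) [Field K] [NumberField K]
      (Dt : ModularParametrizationData W N) (H : HeegnerDatum N (NumberField.discr K)) (ι : K →+* ℂ)
      (P : (W.baseChange K).toAffine.Point),
      p ≠ 2 → W.HasMultiplicativeReductionAtPrime p → ¬ W.HasIrreducibleModPGaloisRep p →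
      W.analyticRank = 1 → W.conductorNorm ℤ = N → IsImaginaryQuadratic K →
      Odd (NumberField.discr K) → NumberField.discr K < -4 → SatisfiesHeegnerHypothesis N K →
      (W.quadraticTwist (NumberField.discr K : ℚ)).entireLFunction 1 ≠ 0 →
      WeierstrassCurve.Affine.Point.map ι.toRatAlgHom P = heegnerPointComplex Dt H →
      ¬ (p : ℤ) ∣ Dt.c → Finite (W.baseChange K).sha →
      (∃ S : X11b.LambdaAdicShadow W K P,
          S.IMCAtTrivialChar ∧ S.WaldspurgerAt ∧ S.ControlAt p ∧ S.TamagawaAtRamifiedAt p) ∧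
        padicValNat p (W.baseChange K).tamagawaProduct = 2 * padicValNat p W.tamagawaProduct) :
    HeegnerIndexIdentity := by
  intro W _ _ p _ N _ K _ _ Dt H ι P hp2 hmult hred hr hN hK hodd hd4 hHN hLt hP hc hfin
  obtain ⟨⟨S, hIMC, hBDP, hCTL, hTAM⟩, htamK⟩ :=
    hlinks W p N K Dt H ι P hp2 hmult hred hr hN hK hodd hd4 hHN hLt hP hc hfin
  haveI := hfin
  exact indexIdentityAt_of_shadowLinks p S hIMC hBDP hCTL hTAM htamK

end Summit.BirchSwinnertonDyer.Rank1Residual.X2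

end
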